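import Literature.AlgebraicGeometry.Resolution.WeightedCentreHasseSubspace
import Literature.AlgebraicGeometry.Resolution.HasseSchmidtDerivatives
import Literature.AlgebraicGeometry.Resolution.HironakaDirectrix

/-!
# Bridge: directional Hasse derivatives ↔ Hasse–Schmidt derivatives ↔ Hironaka's invariance space

INSTRUMENT, NOT a resolution theorem: a DICTIONARY file for the CARVER/TYPER lane of the
Resolution Observatory (engine 1's polynomial weighted-centre toy model `W(f)`, task T29 / N2′).
It connects the Mathlib-only Hasse-subspace file `WeightedCentreHasseSubspace` (directional shift
`dirShift v : H ↦ H(x + Tv)`, directional Hasse derivatives `hasseD v j`, Hasse null space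
`hasseNull n H`) with two files already in the tree:

* (A) `HasseSchmidtDerivatives`: the Taylor morphism `taylor R : H ↦ H(x + u)` and the multi-index
  Hasse–Schmidt derivatives `hasseDeriv R α`.  `aeval_taylor_eq_dirShift`: specialising `u_i ↦ v_i T`
  in `taylor R H` gives `dirShift v H`; `hasseD_eq_sum_hasseDeriv`:
  `D_v^{(j)} H = Σ_{|α| = j} v^α · D^{(α)} H`.
* (B) `HironakaDirectrix`: the translations `translate k w : Y ↦ Y + Tw` of `k[Y, T]` and Hironaka's
  invariance space `invarianceSpace k S = {w | F(Y + Tw) = F(Y) ∀ F ∈ S}`.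
  `optionEquivLeft_translate_rename`: under `optionEquivLeft`, `τ_w (F(Y)) = dirShift w F`;
  `mem_invarianceSpace_iff_hasseD`: `w ∈ 𝕎(S) ↔ ∀ F ∈ S, ∀ j ≥ 1, D_w^{(j)} F = 0`;
  `mem_invarianceSpace_singleton_iff`: for a form `H` of degree `n ≥ 1`,
  `𝕎({H}) = S_n(H) ∩ {H = 0}` (`S_n(H) = hasseNull n H`), hence `𝕎({H}) ≤ S_n(H)`, `H(v + w) = H(v)`
  for `w ∈ 𝕎({H})`, and (C) `𝕎({H}) = ⊥` when no nonzero direction is invariant (hypothesis (P)).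

So the "Hasse subspace" `S` of THEOREM-FS (eng1-g35 §10, LEMMA FSP) contains Hironaka's invariance
space of the form, with equality on the zero set of the form; all statements are elementary and
proved here over an arbitrary commutative ring.  NOT a statement about the
Abramovich–Temkin–Włodarczyk invariant, NOT summit progress; AI-written, AI review is weaker than
expert review.

References (context only): [Hironaka1970AdditiveGroups] §1–2 (translations leaving a form
invariant, differential operators); [Giraud1975] §1.6; [BerthomieuHivertMourtada2010] Cor. 2.3 (the
ridge via Hasse–Schmidt derivatives); [CossartPiltant2008] proof of Prop. 4.2 (the translations
`τ_w`); [VillamayorU2008ReesDiff] §2.6 and [EGAIV4] Thm. 16.11.2 (Taylor morphism, `D^{(α)}`).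
-/

open MvPolynomial

namespace Literature.AlgebraicGeometry.Resolution.WeightedBlowup

namespace HasseDir

/-! ### (A) Directional versus multi-index Hasse–Schmidt derivatives -/

section TaylorBridge

variable {σ : Type*} {R : Type*} [CommRing R]

/-- **`H(x + u)|_{u = Tv} = H(x + Tv)`**: specialising the outer variables `u_i ↦ v_i T` in the
Taylor morphism `taylor` of `HasseSchmidtDerivatives` gives the directional shift `dirShift v`.
(derived here; dictionary) [cite: Hironaka1970AdditiveGroups, §1]
[cite: VillamayorU2008ReesDiff, §2.6 (Tay(f(X)) = Σ Δ^α(f(X)) U^α)] -/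
theorem aeval_taylor_eq_dirShift (v : σ → R) (H : MvPolynomial σ R) :
    MvPolynomial.aeval (R := MvPolynomial σ R)
        (fun i => Polynomial.C (C (v i)) * (Polynomial.X : Polynomial (MvPolynomial σ R)))
        (taylor R H) = dirShift v H := by
  have key : ((MvPolynomial.aeval (R := MvPolynomial σ R)
      (fun i => Polynomial.C (C (v i)) * (Polynomial.X : Polynomial (MvPolynomial σ R)))
        ).restrictScalars R).comp (taylor R) = dirShift v := by
    refine MvPolynomial.algHom_ext fun i => ?_
    rw [AlgHom.comp_apply, AlgHom.restrictScalars_apply, taylor_X, map_add, MvPolynomial.aeval_X,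
      MvPolynomial.algHom_C, Polynomial.algebraMap_eq, dirShift_X]
  exact AlgHom.congr_fun key H

/-- The monomial `u^α` specialises to `v^α T^{|α|}`. (derived here) [cite: Hironaka1970AdditiveGroups, §1] -/
theorem prod_C_mul_X_pow (v : σ → R) (α : σ →₀ ℕ) :
    (α.prod fun i e => (Polynomial.C (C (v i)) * (Polynomial.X : Polynomial (MvPolynomial σ R))) ^ e)
      = Polynomial.C (C (α.prod fun i e => v i ^ e)) * Polynomial.X ^ α.degree := by
  simp only [Finsupp.prod, mul_pow, Finset.prod_mul_distrib, ← map_pow, ← map_prod,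
    Finset.prod_pow_eq_pow_sum, Finsupp.degree_apply]

/-- **Dictionary `D_v^{(j)} = Σ_{|α| = j} v^α D^{(α)}`**: the directional Hasse derivative of
order `j` along `v` is the `v^α`-weighted sum of the multi-index Hasse–Schmidt derivatives
`hasseDeriv R α` of total order `|α| = j`. (derived here; dictionary)
[cite: Hironaka1970AdditiveGroups, §1] [cite: EGAIV4, Thm. 16.11.2 (the operators D_p)] -/
theorem hasseD_eq_sum_hasseDeriv (v : σ → R) (j : ℕ) (H : MvPolynomial σ R) :
    hasseD v j H = ∑ α ∈ (taylor R H).support with α.degree = j,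
      C (α.prod fun i e => v i ^ e) * hasseDeriv R α H := by
  classical
  rw [hasseD_def, ← aeval_taylor_eq_dirShift]
  conv_lhs => rw [(taylor R H).as_sum, map_sum]
  rw [Polynomial.finsetSum_coeff, Finset.sum_filter]
  refine Finset.sum_congr rfl fun α _ => ?_
  rw [MvPolynomial.aeval_monomial, prod_C_mul_X_pow, Polynomial.algebraMap_eq, ← mul_assoc,
    ← map_mul, Polynomial.coeff_C_mul, Polynomial.coeff_X_pow, hasseDeriv_apply]
  by_cases h : α.degree = j
  · rw [if_pos h, if_pos h.symm, mul_one, mul_comm]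
  · rw [if_neg h, if_neg (Ne.symm h), mul_zero]

/-- In particular `D_v^{(1)} H = Σ_i v_i ∂_i H` is the directional derivative: the order-one
multi-indices are the `single i 1`. (derived here) [cite: Hironaka1970AdditiveGroups, §1] -/
theorem hasseD_one_eq_sum (v : σ → R) (H : MvPolynomial σ R) :
    hasseD v 1 H = ∑ α ∈ (taylor R H).support with α.degree = 1,
      C (α.prod fun i e => v i ^ e) * hasseDeriv R α H :=
  hasseD_eq_sum_hasseDeriv v 1 H

end TaylorBridge

/-! ### (B) Hironaka's invariance space = Hasse null space ∩ zero set -/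

section Invariance

variable {k : Type*} [CommRing k] {d : ℕ}

/-- Under `optionEquivLeft` (`T ↦ T`, `Y_i ↦ Y_i` as a constant), a polynomial in the `Y`'s alone
is a constant in `T`. (derived here) [cite: CossartPiltant2008, proof of Prop. 4.2] -/
theorem optionEquivLeft_rename_some (F : MvPolynomial (Fin d) k) :
    optionEquivLeft k (Fin d) (rename some F) = Polynomial.C F := by
  induction F using MvPolynomial.induction_on with
  | C a => rw [rename_C, optionEquivLeft_C]
  | add p q hp hq => rw [map_add, map_add, hp, hq, map_add]
  | mul_X p i hp => rw [map_mul, rename_X, map_mul, hp, optionEquivLeft_X_some, ← map_mul]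

/-- **Translation = directional shift**: `optionEquivLeft (τ_w F(Y)) = F(Y + Tw) = dirShift w F`.
(derived here; dictionary) [cite: CossartPiltant2008, proof of Prop. 4.2]
[cite: Hironaka1970AdditiveGroups, §1] -/
theorem optionEquivLeft_translate_rename (w : Fin d → k) (F : MvPolynomial (Fin d) k) :
    optionEquivLeft k (Fin d) (translate k w (rename some F)) = dirShift w F := by
  have key : (optionEquivLeft k (Fin d)).toAlgHom.comp ((translate k w).comp (rename some))
      = dirShift w := by
    refine MvPolynomial.algHom_ext fun i => ?_
    rw [AlgHom.comp_apply, AlgHom.comp_apply, rename_X, translate_X_some, AlgEquiv.toAlgHom_apply,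
      map_add, map_mul, optionEquivLeft_X_some, optionEquivLeft_X_none, optionEquivLeft_C,
      dirShift_X]
  exact AlgHom.congr_fun key F

/-- **Hironaka's invariance space through Hasse derivatives**: `w ∈ 𝕎(S)` (every `F ∈ S` is
invariant under `Y ↦ Y + Tw`) iff every directional Hasse derivative of positive order along `w`
kills every `F ∈ S`. (derived here; dictionary) [cite: Hironaka1970AdditiveGroups, §1–2]
[cite: BerthomieuHivertMourtada2010, Cor. 2.3] -/
theorem mem_invarianceSpace_iff_hasseD {S : Set (MvPolynomial (Fin d) k)} {w : Fin d → k} :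
    w ∈ invarianceSpace k S ↔ ∀ F ∈ S, ∀ j, 1 ≤ j → hasseD w j F = 0 := by
  rw [mem_invarianceSpace_iff]
  refine forall₂_congr fun F _ => ?_
  rw [← (optionEquivLeft k (Fin d)).injective.eq_iff, optionEquivLeft_translate_rename,
    optionEquivLeft_rename_some]
  constructor
  · intro h j hj
    rw [hasseD_def, h, Polynomial.coeff_C, if_neg (by omega)]
  · intro h
    refine Polynomial.ext fun j => ?_
    rw [Polynomial.coeff_C]
    split_ifs with hj
    · rw [hj, ← hasseD_def, hasseD_zero]
    · rw [← hasseD_def]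
      exact h j (Nat.one_le_iff_ne_zero.mpr hj)

/-- **`𝕎({H}) = S_n(H) ∩ {H = 0}` for a form of degree `n ≥ 1`**: a vector leaves the form `H`
translation-invariant iff it lies in the Hasse null space `hasseNull n H` (orders `1 ≤ j < n`) and
is a zero of `H` (order `j = n`: `D_w^{(n)} H = H(w)`; orders `> n` vanish identically).
(derived here; dictionary) [cite: Hironaka1970AdditiveGroups, §1–2] [cite: Giraud1975, §1.6] -/
theorem mem_invarianceSpace_singleton_iff {n : ℕ} {H : MvPolynomial (Fin d) k}
    (hH : H.IsHomogeneous n) (hn : 1 ≤ n) {w : Fin d → k} :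
    w ∈ invarianceSpace k ({H} : Set (MvPolynomial (Fin d) k)) ↔
      w ∈ hasseNull n H ∧ eval w H = 0 := by
  rw [mem_invarianceSpace_iff_hasseD]
  simp only [Set.mem_singleton_iff, forall_eq]
  constructor
  · intro h
    refine ⟨mem_hasseNull.mpr fun j hj _ => h j hj, ?_⟩
    have htop := h n hn
    rwa [hasseD_eq_C_eval w hH, C_eq_zero] at htop
  · rintro ⟨hw, h0⟩ j hj
    exact hasseD_eq_zero_of_mem_hasseNull_of_eval_eq_zero hH hw h0 hj

/-- Consequently `𝕎({H}) ≤ S_n(H)`. (derived here) [cite: Hironaka1970AdditiveGroups, §1–2] -/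
theorem invarianceSpace_singleton_le_hasseNull {n : ℕ} {H : MvPolynomial (Fin d) k}
    (hH : H.IsHomogeneous n) (hn : 1 ≤ n) :
    invarianceSpace k ({H} : Set (MvPolynomial (Fin d) k)) ≤ hasseNull n H :=
  fun _ hw => ((mem_invarianceSpace_singleton_iff hH hn).mp hw).1

/-- **(S1) in Hironaka's language**: a form `H` of degree `n ≥ 1` is additive along its Hasse null
space — `H(v + w) = H(v) + H(w)` for all `v` and all `w ∈ S_n(H)` — and `S_n(H) ∩ {H = 0}` is
exactly the space of translations leaving `H` invariant. (derived here)
[cite: Hironaka1970AdditiveGroups, §1–2] -/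
theorem eval_add_eq_of_mem_invarianceSpace {n : ℕ} {H : MvPolynomial (Fin d) k}
    (hH : H.IsHomogeneous n) (hn : 1 ≤ n) (v : Fin d → k) {w : Fin d → k}
    (hw : w ∈ invarianceSpace k ({H} : Set (MvPolynomial (Fin d) k))) :
    eval (v + w) H = eval v H := by
  obtain ⟨hwS, hw0⟩ := (mem_invarianceSpace_singleton_iff hH hn).mp hw
  rw [eval_add_of_mem_hasseNull hH hn v hwS, hw0, add_zero]

end Invariance

/-! ### (C) No invariant direction ⇒ trivial invariance space -/

section NoDirection

variable {k : Type*} [CommRing k] {d : ℕ}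

/-- If no `w ≠ 0` has all its positive-order directional Hasse derivatives killing `H` (this is
implied by hypothesis (P) of `finrank_hasseNull_le_one`, where `j ≤ p` suffices for a form of
degree `p`), Hironaka's invariance space `𝕎({H})` is trivial. (derived here)
[cite: Hironaka1970AdditiveGroups, §1–2] -/
theorem invarianceSpace_singleton_eq_bot {H : MvPolynomial (Fin d) k}
    (hP : ∀ u : Fin d → k, u ≠ 0 → ∃ j, 1 ≤ j ∧ hasseD u j H ≠ 0) :
    invarianceSpace k ({H} : Set (MvPolynomial (Fin d) k)) = ⊥ := by
  rw [Submodule.eq_bot_iff]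
  intro w hw
  by_contra hw0
  obtain ⟨j, hj1, hj⟩ := hP w hw0
  exact hj ((mem_invarianceSpace_iff_hasseD.mp hw) H rfl j hj1)

end NoDirection


end HasseDir

end Literature.AlgebraicGeometry.Resolution.WeightedBlowup
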